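import Summits.ResolutionOfSingularities.ResolutionOfSingularities.Theorems.PurelyInseparableDim4SwapTransportWindowPlaySharpPrime
import Summits.ResolutionOfSingularities.ResolutionOfSingularities.Theorems.PurelyInseparableDim4SwapTransportWindowResidualPrime
import HarnessLib
import HarnessLib.Audit.Tags

/-!
# Purely inseparable four-folds — THE ♯-VIRTUAL WINDOW FROM A SATELLITE ENTRY, EVERY PRIME: the flagless light-pair power-cone killer with
# rotations MODULO THE ENTRY♯ (cell `res-dim4-pi`, K2(p) lane, rung-1 POWER-CONE LINE «light pair of TAIL(p, p−1, 3) ∀ p», flagless branch,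
# FILE ♯7 part R♯ = W6a with the ♯-frame; seat res-dim4-typ-1 g6)

[OURS · counted 0 · cell `res-dim4-pi` · K2(p) lane (holder res-dim4-p-12 g5, rulings g5-23 / g5-26 / g5-27); res-dim4-p-3 g6's MEMO FLAGLESS♯
and port plan §6.]  Nothing here proves K2(p) for any `p`, any TAIL(p, p−1, 3), FLAGLESS♯, `NoIsolatedTrap p p` or resolution of singularities
in dimension ≥ 4 / characteristic `p` — NOT proved.  AI kernel work, weaker than expert review.  The FLAGLESS light-pair sub-row is here reduced
to TWO hypotheses taken BY VALUE (holder g5-26): `hE` (the ENTRY♯: beyond every index some real time carries a ♯-framed virtual partner —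
regime R, LAYER, dead row `(u, f) = (d − 3 − c, c)`, row ♯-flag `x_λ²x_μ²u^{d−2−c}x_f^c ≠ 0` — for every precision and jet; res-dim4-p-3's ♯8)
and `hVT` (the row-`c` PINNING as a closed statement: ♯1 `coeff_sharp_step_translate_u` at `c = 0`, res-dim4-p-3's
`coeff_level_step_translate_u` at level `2` for every row).  Neither is proved in this file.

* §1 **`virtual_window_false_at_sharp_prime`** — an entry♯ at a real time `k` whose step re-creates the slot `π₀ λ` and whose NEXT step is
  SATELLITE feeds B♯ `virtual_window_false_of_entry_sharp_prime` (`ℓs 0 = λ`, `ℓs 1 = μ` read off the recursion rule; recursion data and common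
  certificate by W6a `exists_virtual_data_prime` / `exists_common_cert_prime`); window `T ≥ 4(d − 1) + 2`, real regime up to `k + T + 2`.
* §2 **`cInf_no_chain_of_entry_sharp_prime`** — an isolated above-floor `Step0 p` chain with `x^{r₀} ∣ F₀`, shade `d` (`d + 1 = p`, `4 ≤ d`)
  and `e_G = 3` from `k₀`, weights `≤ 1` of degree `2`, witnessed with rotations ALLOWED, is impossible MODULO THE ENTRY♯ `hE`: free-tail lemma
  for a satellite time `s ≥ k`, I♯ `virtual_iterate_sharp_prime` to `s`, §1 at `s` (naming `λ ↔ μ` by G1 `step_cases_of_weights_prime`).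
[cite: Hauser2010, §§F–G] [cite: CossartJannsenSaito2020, Thm. 3.14]
bears_on: LADDER-RESOLUTION:D157-DOOR2 (res-dim4-pi · K2(p) · power cones · flagless branch ♯7 ♯-window residual).  Supports
stmt-ResolutionOfSingularities-16155 (helper).
-/

set_option linter.dupNamespace false -- mandated namespace of this single-conjunct summit

noncomputable section

namespace Summit.ResolutionOfSingularities.ResolutionOfSingularities.Theorems.PIDim4

namespace SwapTransport

open MvPolynomial Finset
open Literature.AlgebraicGeometry.Resolution
open Literature.AlgebraicGeometry.Resolution.CentreBlowup
open Literature.AlgebraicGeometry.Resolution.Hauser2010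
open Literature.AlgebraicGeometry.Resolution.HauserPerlega2019

variable {K : Type} [Field K] [DecidableEq K]

/-! ## §1 The ♯-window from a satellite entry, every prime -/

/-- **THE ♯-VIRTUAL WINDOW FROM A SATELLITE ENTRY, every prime** (module docstring §1). [OURS] [cite: Hauser2010, §§F–G]
[cite: CossartJannsenSaito2020, Thm. 3.14] -/
theorem virtual_window_false_at_sharp_prime (p : ℕ) [Fact p.Prime] [CharP K p] {d ef : ℕ} (hdp : d + 1 = p) (hef : ef + 3 ≤ d)
    {la mu u f : Fin 4} (hlm : la ≠ mu) (hlu : la ≠ u) (hlf : la ≠ f) (hmu : mu ≠ u) (hmf : mu ≠ f) (huf : u ≠ f)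
    (hVT : ∀ (x y : Fin 4) (B : State K) (β : K), x ≠ y → x ≠ u → x ≠ f → y ≠ u → y ≠ f →
      ordZero B.F = ((d + 2 : ℕ) : ℕ∞) → (∀ e ∈ B.F.support, e f = ef → 3 ≤ e x) →
      coeff (Finsupp.single x 4 + Finsupp.single y 3 + Finsupp.single u (d - 3 - ef) + Finsupp.single f ef) B.F = 0 →
      coeff (Finsupp.single x 3 + Finsupp.single y 3 + Finsupp.single u (d - 2 - ef) + Finsupp.single f ef) B.F ≠ 0 →
      coeff (Finsupp.single x 3 + Finsupp.single y 3 + Finsupp.single u (d - 3 - ef) + Finsupp.single f ef)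
        (CentreBlowup.step p Finset.univ x (Function.update (0 : Fin 4 → K) u β) B).F = 0 → β = 0)
    {c : ℕ → State K} {j : ℕ → Fin 4} {b : ℕ → Fin 4 → K} (hw : FreeTail.IsWitnessedChain p c j b) {k Nc T : ℕ}
    (hT : 4 * (d - 1) + 2 ≤ T) (hisoR : ∀ t, t ≤ T + 2 → IsIsolated p (c (k + t)).F)
    (hcert : ∀ t, t ≤ T + 2 → originIdeal K ^ Nc ≤ singLocusIdeal p (c (k + t)).F ⊔ originIdeal K ^ (Nc + 1))
    (hoR : ∀ t, t ≤ T + 2 → ordZero (c (k + t)).F = ((d + 2 : ℕ) : ℕ∞))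
    (he3R : ∀ t, t ≤ T + 2 → Module.finrank K (ResCone.resVertex (c (k + t))) = 3)
    (hwtR : ∀ t, t ≤ T + 2 → (∀ i, (c (k + t)).r i ≤ 1) ∧ (c (k + t)).r.degree = 2)
    (hdivR : ∀ t, t ≤ T + 2 → ∀ e ∈ (c (k + t)).F.support, (c (k + t)).r ≤ e)
    {π₀ : Equiv.Perm (Fin 4)} {B₀ : State K} {M N : ℕ} (hM : Nc + 3 * p + 2 + p * (T + 1) ≤ M) (hN : d + 5 + d * (T + 1) ≤ N)
    (hrel0 : ∃ (θ e : Fin 4 → MvPolynomial (Fin 4) K) (U E : MvPolynomial (Fin 4) K),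
      θ (π₀ la) = X la * e la ∧ θ (π₀ mu) = X mu * e mu ∧ constantCoeff (e la) ≠ 0 ∧ constantCoeff (e mu) ≠ 0 ∧
      constantCoeff (θ (π₀ u)) = 0 ∧ constantCoeff (θ (π₀ f)) = 0 ∧
      coeff (Finsupp.single u 1) (θ (π₀ u)) * coeff (Finsupp.single f 1) (θ (π₀ f)) -
        coeff (Finsupp.single f 1) (θ (π₀ u)) * coeff (Finsupp.single u 1) (θ (π₀ f)) ≠ 0 ∧
      constantCoeff U ≠ 0 ∧ E ∈ originIdeal K ^ M ∧ B₀.F = deletePthPowers p (U ^ p * aeval θ (c k).F) + E)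
    (hrA0 : (c k).r = Finsupp.single (π₀ la) 1 + Finsupp.single (π₀ mu) 1)
    (hfr0 : ordZero B₀.F = ((d + 2 : ℕ) : ℕ∞) ∧ B₀.r = Finsupp.single la 1 + Finsupp.single mu 1 ∧
      (∀ e ∈ B₀.F.support, B₀.r ≤ e) ∧ (∃ a : K, a ≠ 0 ∧ ResCone.resForm B₀ = C a * X f ^ d) ∧
      (∀ e ∈ B₀.F.support, e.degree = d + 2 → e = Finsupp.single la 1 + Finsupp.single mu 1 + Finsupp.single u 0 + Finsupp.single f d) ∧
      (∀ e ∈ B₀.F.support, e f ≤ d - 1 → 2 ≤ e la ∧ 2 ≤ e mu) ∧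
      (∀ e ∈ B₀.F.support, e f + 2 ≤ d → 3 ≤ e la) ∧ (∀ e ∈ B₀.F.support, e f + 2 ≤ d → 3 ≤ e mu) ∧
      (∀ E : Fin 4 →₀ ℕ, E.degree = d + 3 → E f + 2 ≤ d → coeff E B₀.F = 0) ∧
      (∀ e ∈ B₀.F.support, e.degree < N → ¬ (e u = d - 3 - ef ∧ e f = ef)) ∧
      coeff (Finsupp.single la 3 + Finsupp.single mu 3 + Finsupp.single u (d - 2 - ef) + Finsupp.single f ef) B₀.F ≠ 0 ∧
      IsIsolated p B₀.F ∧ Module.finrank K (ResCone.resVertex B₀) = 3)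
    (hstart : j k = π₀ la ∨ (j k ≠ π₀ la ∧ j k ≠ π₀ mu ∧ b k (π₀ la) ≠ 0)) (hsat : FreeTail.IsSatellite j b k) :
    False := by
  obtain ⟨πs, Bs, ℓs, hπ0, hB0, hBs, hℓs, hπs⟩ := exists_virtual_data_prime p j b k la mu π₀ B₀
  subst hπ0 hB0
  have hπlm : πs 0 la ≠ πs 0 mu := fun h => hlm ((πs 0).injective h)
  -- the first virtual chart is `λ`, and `πs 1 λ` is the newest real letter `j k`
  have hx0 : ℓs 0 = la := by
    rw [hℓs 0, Nat.add_zero]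
    rcases hstart with h | ⟨h1, h2, h3⟩
    · rw [if_pos h]
    · rw [if_neg h1, if_neg h2, if_pos h3]
  have hπ1 : πs 1 la = j k := by
    rw [hπs 0, Nat.add_zero]
    rcases hstart with h | ⟨h1, h2, -⟩
    · rw [if_pos (Or.inl h), h]
    · rw [if_neg (not_or.mpr ⟨h1, h2⟩), hx0, Equiv.trans_apply, Equiv.swap_apply_left, Equiv.apply_symm_apply]
  -- the satellite step `k + 1` charts the other slot: `ℓs 1 = μ`
  have hx1 : ℓs 1 = mu := by
    obtain ⟨hne, hb0⟩ := hsat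
    rw [hℓs 1, hπ1, if_neg hne]
    by_cases h : j (k + 1) = πs 1 mu
    · rw [if_pos h]
    · rw [if_neg h, if_neg (not_not.mpr hb0)]
  exact virtual_window_false_of_entry_sharp_prime p hdp hef hlm hlu hlf hmu hmf huf hVT hw hT hisoR hcert hoR he3R hwtR hdivR hBs hℓs
    hπs hM hN hrel0 hrA0 hfr0 hx0 hx1

/-! ## §2 The flagless light-pair killer with rotations, modulo the entry♯, every prime -/

/-- **THE FLAGLESS LIGHT-PAIR POWER-CONE CONFIGURATION WITH ROTATIONS IS IMPOSSIBLE — MODULO THE ENTRY♯ `hE`, every prime** (module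
docstring §2). [OURS] [cite: Hauser2010, §§F–G] [cite: CossartJannsenSaito2020, Thm. 3.14] -/
theorem cInf_no_chain_of_entry_sharp_prime (p : ℕ) [Fact p.Prime] [CharP K p] {d ef : ℕ} (hdp : d + 1 = p) (hef : ef + 3 ≤ d)
    (hVT : ∀ (x y u f : Fin 4) (B : State K) (β : K), x ≠ y → x ≠ u → x ≠ f → y ≠ u → y ≠ f → u ≠ f →
      ordZero B.F = ((d + 2 : ℕ) : ℕ∞) → (∀ e ∈ B.F.support, e f = ef → 3 ≤ e x) →
      coeff (Finsupp.single x 4 + Finsupp.single y 3 + Finsupp.single u (d - 3 - ef) + Finsupp.single f ef) B.F = 0 →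
      coeff (Finsupp.single x 3 + Finsupp.single y 3 + Finsupp.single u (d - 2 - ef) + Finsupp.single f ef) B.F ≠ 0 →
      coeff (Finsupp.single x 3 + Finsupp.single y 3 + Finsupp.single u (d - 3 - ef) + Finsupp.single f ef)
        (CentreBlowup.step p Finset.univ x (Function.update (0 : Fin 4 → K) u β) B).F = 0 → β = 0)
    {c : ℕ → State K} {j : ℕ → Fin 4} {b : ℕ → Fin 4 → K}
    (hc : ∀ k, IsIsolated p (c k).F ∧ Step0 p (c k) (c (k + 1))) (hw : FreeTail.IsWitnessedChain p c j b)
    (hr0 : ∀ e ∈ (c 0).F.support, (c 0).r ≤ e) (hfloor : ∀ k, ordZero (c k).F ≠ (p : ℕ)) {k₀ : ℕ}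
    (hshade : ∀ k, k₀ ≤ k → (c k).shade = ((d : ℕ) : ℕ∞))
    (he3 : ∀ k, k₀ ≤ k → Module.finrank K (ResCone.resVertex (c k)) = 3)
    (hwt : ∀ k, k₀ ≤ k → (∀ i, (c k).r i ≤ 1) ∧ (c k).r.degree = 2)
    (hE : ∀ k₂, ∃ k, k₂ ≤ k ∧ ∃ (la mu u f : Fin 4) (π₀ : Equiv.Perm (Fin 4)),
      la ≠ mu ∧ la ≠ u ∧ la ≠ f ∧ mu ≠ u ∧ mu ≠ f ∧ u ≠ f ∧
      (c k).r = Finsupp.single (π₀ la) 1 + Finsupp.single (π₀ mu) 1 ∧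
      ∀ M N : ℕ, ∃ B₀ : State K,
        (∃ (θ e : Fin 4 → MvPolynomial (Fin 4) K) (U E : MvPolynomial (Fin 4) K),
          θ (π₀ la) = X la * e la ∧ θ (π₀ mu) = X mu * e mu ∧ constantCoeff (e la) ≠ 0 ∧ constantCoeff (e mu) ≠ 0 ∧
          constantCoeff (θ (π₀ u)) = 0 ∧ constantCoeff (θ (π₀ f)) = 0 ∧
          coeff (Finsupp.single u 1) (θ (π₀ u)) * coeff (Finsupp.single f 1) (θ (π₀ f)) -
            coeff (Finsupp.single f 1) (θ (π₀ u)) * coeff (Finsupp.single u 1) (θ (π₀ f)) ≠ 0 ∧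
          constantCoeff U ≠ 0 ∧ E ∈ originIdeal K ^ M ∧ B₀.F = deletePthPowers p (U ^ p * aeval θ (c k).F) + E) ∧
        ordZero B₀.F = ((d + 2 : ℕ) : ℕ∞) ∧ B₀.r = Finsupp.single la 1 + Finsupp.single mu 1 ∧
        (∀ e ∈ B₀.F.support, B₀.r ≤ e) ∧ (∃ a : K, a ≠ 0 ∧ ResCone.resForm B₀ = C a * X f ^ d) ∧
        (∀ e ∈ B₀.F.support, e.degree = d + 2 → e = Finsupp.single la 1 + Finsupp.single mu 1 + Finsupp.single u 0 + Finsupp.single f d) ∧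
        (∀ e ∈ B₀.F.support, e f ≤ d - 1 → 2 ≤ e la ∧ 2 ≤ e mu) ∧
        (∀ e ∈ B₀.F.support, e f + 2 ≤ d → 3 ≤ e la) ∧ (∀ e ∈ B₀.F.support, e f + 2 ≤ d → 3 ≤ e mu) ∧
        (∀ E : Fin 4 →₀ ℕ, E.degree = d + 3 → E f + 2 ≤ d → coeff E B₀.F = 0) ∧
        (∀ e ∈ B₀.F.support, e.degree < N → ¬ (e u = d - 3 - ef ∧ e f = ef)) ∧
        coeff (Finsupp.single la 3 + Finsupp.single mu 3 + Finsupp.single u (d - 2 - ef) + Finsupp.single f ef) B₀.F ≠ 0 ∧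
        IsIsolated p B₀.F ∧ Module.finrank K (ResCone.resVertex B₀) = 3) : False := by
  obtain ⟨k, hk, la, mu, u, f, π₀, hlm, hlu, hlf, hmu, hmf, huf, hrA0, hB⟩ := hE k₀
  have hd2 : 2 ≤ d := by omega
  -- the window length of the game
  set Tw : ℕ := 4 * (d - 1) + 2 with hTw
  -- global regime facts
  have hiso : ∀ k, IsIsolated p (c k).F := fun k => (hc k).1
  have ho6 : ∀ m, k₀ ≤ m → ordZero (c m).F = ((d + 2 : ℕ) : ℕ∞) := fun m hm => by
    obtain ⟨o, ho, -, -, hod⟩ := ResCone.chain_shade_nat p hc hfloor hshade hm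
    rw [(hwt m hm).2] at hod
    have h6 : o = d + 2 := by omega
    rw [ho, h6]
  have hdiv : ∀ m, ∀ e ∈ (c m).F.support, (c m).r ≤ e := IsolatedBand.isolated_chain_forall_le hc hr0
  -- a satellite time `s = k + T`
  obtain ⟨s, hks, hsat⟩ := (FreeTail.satelliteRecurrenceAt_iff_noIsolatedFreeTailAt p p).mpr
    (FreeTailProof.noIsolatedFreeTailAt_self p) K c j b hw hiso k
  obtain ⟨T, rfl⟩ : ∃ T, s = k + T := ⟨s - k, by omega⟩
  -- a common certificate on `c k, …, c (k + T + Tw + 2)`, the budgets, the entry and the virtual data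
  obtain ⟨Nc, hcert⟩ := exists_common_cert_prime p (T := T + (Tw + 2)) (fun t _ => hiso (k + t))
  obtain ⟨B₀, hrel0, hfr0⟩ := hB (Nc + 3 * p + 2 + p * (Tw + 1) + p * T) (d + 5 + d * (Tw + 1) + d * T)
  obtain ⟨πs, Bs, ℓs, hπ0, hB0, hBs, hℓs, hπs⟩ := exists_virtual_data_prime p j b k la mu π₀ B₀
  subst hπ0 hB0
  -- phase 1: iterate to the satellite time
  have hVTu : ∀ (x y : Fin 4) (B : State K) (β : K), x ≠ y → x ≠ u → x ≠ f → y ≠ u → y ≠ f →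
      ordZero B.F = ((d + 2 : ℕ) : ℕ∞) → (∀ e ∈ B.F.support, e f = ef → 3 ≤ e x) →
      coeff (Finsupp.single x 4 + Finsupp.single y 3 + Finsupp.single u (d - 3 - ef) + Finsupp.single f ef) B.F = 0 →
      coeff (Finsupp.single x 3 + Finsupp.single y 3 + Finsupp.single u (d - 2 - ef) + Finsupp.single f ef) B.F ≠ 0 →
      coeff (Finsupp.single x 3 + Finsupp.single y 3 + Finsupp.single u (d - 3 - ef) + Finsupp.single f ef)
        (CentreBlowup.step p Finset.univ x (Function.update (0 : Fin 4 → K) u β) B).F = 0 → β = 0 :=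
    fun x y B β hxy hxu hxf hyu hyf => hVT x y u f B β hxy hxu hxf hyu hyf huf
  obtain ⟨hrelT, hrAT, hfrT⟩ := virtual_iterate_sharp_prime p hdp hef hlm hlu hlf hmu hmf huf hVTu hw (T := T)
    (fun t _ => hiso (k + t)) (fun t ht => hcert t (by omega)) (fun t _ => ho6 (k + t) (by omega))
    (fun t _ => he3 (k + t) (by omega)) (fun t _ => hwt (k + t) (by omega)) (fun t _ => hdiv (k + t)) hBs hℓs hπs (by omega)
    (by omega) hrel0 hrA0 hfr0 T le_rfl
  -- phase 2 inputs at the base `k + T`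
  have hcertW : ∀ t, t ≤ Tw + 2 → originIdeal K ^ Nc ≤ singLocusIdeal p (c (k + T + t)).F ⊔ originIdeal K ^ (Nc + 1) :=
    fun t ht => by rw [Nat.add_assoc]; exact hcert (T + t) (by omega)
  have hisoW : ∀ t, t ≤ Tw + 2 → IsIsolated p (c (k + T + t)).F := fun t _ => hiso _
  have hoW : ∀ t, t ≤ Tw + 2 → ordZero (c (k + T + t)).F = ((d + 2 : ℕ) : ℕ∞) := fun t _ => ho6 _ (by omega)
  have he3W : ∀ t, t ≤ Tw + 2 → Module.finrank K (ResCone.resVertex (c (k + T + t))) = 3 := fun t _ => he3 _ (by omega)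
  have hwtW : ∀ t, t ≤ Tw + 2 → (∀ i, (c (k + T + t)).r i ≤ 1) ∧ (c (k + T + t)).r.degree = 2 :=
    fun t _ => hwt _ (by omega)
  have hdivW : ∀ t, t ≤ Tw + 2 → ∀ e ∈ (c (k + T + t)).F.support, (c (k + T + t)).r ≤ e := fun t _ => hdiv _
  have hM : Nc + 3 * p + 2 + p * (Tw + 1) ≤ Nc + 3 * p + 2 + p * (Tw + 1) + p * T - p * T := by omega
  have hN : d + 5 + d * (Tw + 1) ≤ d + 5 + d * (Tw + 1) + d * T - d * T := by omega
  -- the swapped-orientation copies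
  obtain ⟨θ, e, U, E, h1, h2, h3, h4, h5, h6, h7, h8, h9, h10⟩ := hrelT
  obtain ⟨hoT, hrT, hdivT, hformT, hstrT, hledT, hRlT, hRmT, hlayT, hrowT, hgT, hisoT, he3T⟩ := hfrT
  have hrelS : ∃ (θ e : Fin 4 → MvPolynomial (Fin 4) K) (U E : MvPolynomial (Fin 4) K),
      θ (πs T mu) = X mu * e mu ∧ θ (πs T la) = X la * e la ∧ constantCoeff (e mu) ≠ 0 ∧ constantCoeff (e la) ≠ 0 ∧
      constantCoeff (θ (πs T u)) = 0 ∧ constantCoeff (θ (πs T f)) = 0 ∧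
      coeff (Finsupp.single u 1) (θ (πs T u)) * coeff (Finsupp.single f 1) (θ (πs T f)) -
        coeff (Finsupp.single f 1) (θ (πs T u)) * coeff (Finsupp.single u 1) (θ (πs T f)) ≠ 0 ∧
      constantCoeff U ≠ 0 ∧ E ∈ originIdeal K ^ (Nc + 3 * p + 2 + p * (Tw + 1) + p * T - p * T) ∧
      (Bs T).F = deletePthPowers p (U ^ p * aeval θ (c (k + T)).F) + E :=
    ⟨θ, e, U, E, h2, h1, h4, h3, h5, h6, h7, h8, h9, h10⟩
  have hrAS : (c (k + T)).r = Finsupp.single (πs T mu) 1 + Finsupp.single (πs T la) 1 := by rw [hrAT, add_comm]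
  have hfrS : ordZero (Bs T).F = ((d + 2 : ℕ) : ℕ∞) ∧ (Bs T).r = Finsupp.single mu 1 + Finsupp.single la 1 ∧
      (∀ e ∈ (Bs T).F.support, (Bs T).r ≤ e) ∧ (∃ a : K, a ≠ 0 ∧ ResCone.resForm (Bs T) = C a * X f ^ d) ∧
      (∀ e ∈ (Bs T).F.support, e.degree = d + 2 →
        e = Finsupp.single mu 1 + Finsupp.single la 1 + Finsupp.single u 0 + Finsupp.single f d) ∧
      (∀ e ∈ (Bs T).F.support, e f ≤ d - 1 → 2 ≤ e mu ∧ 2 ≤ e la) ∧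
      (∀ e ∈ (Bs T).F.support, e f + 2 ≤ d → 3 ≤ e mu) ∧ (∀ e ∈ (Bs T).F.support, e f + 2 ≤ d → 3 ≤ e la) ∧
      (∀ E : Fin 4 →₀ ℕ, E.degree = d + 3 → E f + 2 ≤ d → coeff E (Bs T).F = 0) ∧
      (∀ e ∈ (Bs T).F.support, e.degree < d + 5 + d * (Tw + 1) + d * T - d * T → ¬ (e u = d - 3 - ef ∧ e f = ef)) ∧
      coeff (Finsupp.single mu 3 + Finsupp.single la 3 + Finsupp.single u (d - 2 - ef) + Finsupp.single f ef) (Bs T).F ≠ 0 ∧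
      IsIsolated p (Bs T).F ∧ Module.finrank K (ResCone.resVertex (Bs T)) = 3 := by
    refine ⟨hoT, by rw [hrT, add_comm], hdivT, hformT, fun e he hdeg => (hstrT e he hdeg).trans (ResCone.cone_comm mu la u f d),
      fun e he hf => (hledT e he hf).symm, hRmT, hRlT, hlayT, hrowT, ?_, hisoT, he3T⟩
    rw [add_comm (Finsupp.single mu 3) (Finsupp.single la 3)]; exact hgT
  -- which slot does the step at `k + T` re-create?
  have hdp2 : d + 2 = p + 1 := by omega
  have hπlm : πs T la ≠ πs T mu := fun h => hlm ((πs T).injective h)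
  have hπlu : πs T la ≠ πs T u := fun h => hlu ((πs T).injective h)
  have hπlf : πs T la ≠ πs T f := fun h => hlf ((πs T).injective h)
  have hπmu : πs T mu ≠ πs T u := fun h => hmu ((πs T).injective h)
  have hπmf : πs T mu ≠ πs T f := fun h => hmf ((πs T).injective h)
  have hπuf : πs T u ≠ πs T f := fun h => huf ((πs T).injective h)
  obtain ⟨-, -, -, -, hcs⟩ := hw (k + T)
  have hw1' : ∀ i, (CentreBlowup.step p Finset.univ (j (k + T)) (b (k + T)) (c (k + T))).r i ≤ 1 := fun i => by
    rw [← hcs]; exact (hwt (k + T + 1) (by omega)).1 i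
  have hdeg' : (CentreBlowup.step p Finset.univ (j (k + T)) (b (k + T)) (c (k + T))).r.degree = 2 := by
    rw [← hcs]; exact (hwt (k + T + 1) (by omega)).2
  have hoT1 : ordZero (c (k + T)).F = ((p + 1 : ℕ) : ℕ∞) := by rw [ho6 (k + T) (by omega), hdp2]
  rcases step_cases_of_weights_prime p hπlm hπlu hπlf hπmu hπmf hπuf hrAT hoT1 hw1' hdeg' with
    ⟨hjr, -, -⟩ | ⟨hjr, -, -⟩ | ⟨hjr, hrot⟩
  · exact virtual_window_false_at_sharp_prime p hdp hef hlm hlu hlf hmu hmf huf hVTu hw le_rfl hisoW hcertW hoW he3W hwtW hdivW hM hN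
      ⟨θ, e, U, E, h1, h2, h3, h4, h5, h6, h7, h8, h9, h10⟩ hrAT
      ⟨hoT, hrT, hdivT, hformT, hstrT, hledT, hRlT, hRmT, hlayT, hrowT, hgT, hisoT, he3T⟩ (Or.inl hjr) hsat
  · exact virtual_window_false_at_sharp_prime p hdp hef hlm.symm hmu hmf hlu hlf huf hVTu hw le_rfl hisoW hcertW hoW he3W hwtW hdivW
      hM hN hrelS hrAS hfrS (Or.inl hjr) hsat
  · have hjl : j (k + T) ≠ πs T la := by rcases hjr with h | h <;> rw [h] <;> [exact hπlu.symm; exact hπlf.symm]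
    have hjm : j (k + T) ≠ πs T mu := by rcases hjr with h | h <;> rw [h] <;> [exact hπmu.symm; exact hπmf.symm]
    rcases hrot with ⟨hbla, -, -⟩ | ⟨hbmu, -, -⟩
    · exact virtual_window_false_at_sharp_prime p hdp hef hlm hlu hlf hmu hmf huf hVTu hw le_rfl hisoW hcertW hoW he3W hwtW hdivW hM
        hN ⟨θ, e, U, E, h1, h2, h3, h4, h5, h6, h7, h8, h9, h10⟩ hrAT
        ⟨hoT, hrT, hdivT, hformT, hstrT, hledT, hRlT, hRmT, hlayT, hrowT, hgT, hisoT, he3T⟩ (Or.inr ⟨hjl, hjm, hbla⟩) hsat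
    · exact virtual_window_false_at_sharp_prime p hdp hef hlm.symm hmu hmf hlu hlf huf hVTu hw le_rfl hisoW hcertW hoW he3W hwtW
        hdivW hM hN hrelS hrAS hfrS (Or.inr ⟨hjm, hjl, hbmu⟩) hsat

end SwapTransport

end Summit.ResolutionOfSingularities.ResolutionOfSingularities.Theorems.PIDim4

end
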